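import Mathlib
import Summits.MatrixMultiplication.MatrixMultiplication.Theorems.SnSubsetDichotomyHyperoctahedralThresholdWordCollisions

/-!
# Single-colour reflection supply by pigeonhole on involution words
# (crux `SnSubsetDichotomy.HyperoctahedralThreshold`, stmt-MatrixMultiplication-10883, refutation line)

Siege seat k23 (variation "direct pigeonhole on involution words"): a `--supports` helper for the open core
`stub_poorRigidCore` of the line `Cruxes/HyperoctahedralThreshold/Lines/refutation_local_symmetry.lean`
(lead c3): the finitary SUPPLY (15.1) of the crux notes (`NOTES.md` §15.1, single-colour form of (S1), §9)
in its sharpest form, registered as `stub_sameColourSupplySharp` — dyadic suffix weights AND off-diagonal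
cells; it implies both earlier tree versions, the lead's `…StubSameColourSupply.lean` (`Supply.…`, weights
`3^i`; via `sum_Icc_le_sum_range_three_pow`) and siege k29's density form (`…SameColourDarts.lean` and
sequel, all `n²` cells), and adds the presentation / commutator lemmas below.  Planners: keep one.

Setting: three involutions `μ c` of `Fin n` (colours), words acting on the right,
`x · w = w.foldl (fun v e => μ e v) x`.  A (based, oriented) SAME-COLOUR REFLECTION STRUCTURE of colour `c`
and length `m` is a pair `(a, h)` with `h` reduced of length `m`, `first(h) ≠ c ≠ last(h)`, and
`μ c (a · h) = (μ c a) · h` — the `c`-edge at `a` is carried by `h` onto a `c`-edge, i.e. a loop-to-loop path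
of the rung graph between two loops of colour `c`, i.e. `a ∈ Fix (c h c h⁻¹)`
(`structure_iff_foldl_commutator`).  `Π_c(m)` denotes their number (the finset is written out; its two
natural presentations agree, `structures_eq`).

Results:
* `sq_le_offDiag_mul_sameColourStructures` (fixed-point-free `μ`):
    `(n · 2^k)² ≤ (n² - n) · (n · 2^k + Σ_{d=1}^{k} 2^(k-d) · Π_c(2d))`;
* `four_pow_le_sameColourStructures` (any involutions, `0 < n`):
    `4^k ≤ n · 2^k + Σ_{d=1}^{k} 2^(k-d) · Π_c(2d)`.
Proof (pigeonhole on the involution words `g⁻¹ c g`): the `n · 2^k` items `(a, g)` (`g` reduced of length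
`k`, `first(g) ≠ c`) go to the ordered pairs `(a · g, (μ c a) · g)` (off-diagonal when `μ c` has no fixed
point); Cauchy–Schwarz on the fibres (`card_sq_le_card_mul_collisions` of the sibling file) bounds the
collisions from below, and a collision `((a,g),(a',g'))` split at the longest common suffix `s` of
`g = p ++ s`, `g' = p' ++ s` yields the structure `(a, p ++ p'.reverse)` of length `2|p|`
(`collision_structure`); `(|p|, structure, s)` determines the collision and there are at most `2^(k-|p|)`
suffixes per structure (`card_collisions_le`).  Reading: with `2^k = 2^{C/2} n` and `ρ_m := Π_c(m)/2^m` the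
density form says `Σ_i ρ_{2k-2i} 2^{-i} ≥ 1 - 2^{-C/2}`, so some scale `m ≤ 2k ≈ 2 log₂ n + C` carries
`Π_c(m) ≳ 2^m` structures — the supply against which cleanness must be counted (§15.2).
What is NOT here: cleanness (J-independence of the rungs `{a, μ c a} · h_[t]`), which is the open core.
-/

-- the project's summit namespace `Summit.MatrixMultiplication.MatrixMultiplication` repeats a component by design (D-0022)
set_option linter.dupNamespace false

namespace Summit.MatrixMultiplication.MatrixMultiplication.Theorems.HyperoctahedralThreshold.SameColourSupply

open Finset

variable {n : ℕ}

/-! ### From a collision to a same-colour reflection structure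

Fix the colour `c` and a length `k`.  ITEMS are pairs `(a, g)`: a point `a` (standing for the loop dart
`a → μ c a` of colour `c`) and a reduced word `g` of length `k` not starting with `c`; the item is sent to
the ordered pair of points `(a · g, (μ c a) · g)`.  A COLLISION is an ordered pair of distinct items with the
same image.  Splitting the two words of a collision `((a, g), (a', g'))` at their longest common suffix `s`,
`g = p ++ s`, `g' = p' ++ s` (`|p| = |p'| = D ≥ 1`, last letters of `p, p'` distinct), the word
`h := p ++ p'.reverse` is reduced of length `2 D`, does not start or end with `c`, and carries the dart at `a`
onto the dart at `a'`: `a · h = a'`, `(μ c a) · h = μ c a'` — a (based, oriented) SAME-COLOUR REFLECTION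
STRUCTURE `(a, h)` of colour `c` and length `2 D` (crux NOTES §15.1), i.e. `a ∈ Fix (c h c h⁻¹)`.
The collision is recovered from `(D, (a, h), s)`, and `s` is a reduced word of length `k - D` not starting
with the last letter of `p`. -/

/-- **Collision ⇒ structure.**  The analysis of one collision described above. -/
theorem collision_structure (μ : Fin 3 → Equiv.Perm (Fin n)) (hμ : ∀ c, μ c * μ c = 1) (c : Fin 3)
    {k : ℕ} {a a' : Fin n} {g g' : List (Fin 3)}
    (hg : g ∈ ((univ : Finset (List.Vector (Fin 3) k)).image (fun v => v.toList)).filter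
        (fun g => List.IsChain (· ≠ ·) g ∧ g.head? ≠ some c))
    (hg' : g' ∈ ((univ : Finset (List.Vector (Fin 3) k)).image (fun v => v.toList)).filter
        (fun g => List.IsChain (· ≠ ·) g ∧ g.head? ≠ some c))
    (hne : (a, g) ≠ (a', g'))
    (h1 : g.foldl (fun v e => μ e v) a = g'.foldl (fun v e => μ e v) a')
    (h2 : g.foldl (fun v e => μ e v) (μ c a) = g'.foldl (fun v e => μ e v) (μ c a'))
    {D : ℕ} (hD : D = Nat.find (exists_drop_eq g g')) :
    (1 ≤ D ∧ D ≤ k) ∧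
    ((g.take D ++ (g'.take D).reverse).foldl (fun v e => μ e v) a = a' ∧
      (g.take D ++ (g'.take D).reverse).foldl (fun v e => μ e v) (μ c a) = μ c a') ∧
    (a, g.take D ++ (g'.take D).reverse) ∈
      (((univ : Finset (Fin n)) ×ˢ
          ((univ : Finset (List.Vector (Fin 3) (2 * D))).image (fun v => v.toList))).filter
        (fun ah => List.IsChain (· ≠ ·) ah.2 ∧ ah.2.head? ≠ some c ∧ ah.2.getLast? ≠ some c ∧
          ah.2.foldl (fun v e => μ e v) (μ c ah.1) = μ c (ah.2.foldl (fun v e => μ e v) ah.1))) ∧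
    g.drop D ∈ ((univ : Finset (List.Vector (Fin 3) (k - D))).image (fun v => v.toList)).filter
        (fun s => List.IsChain (· ≠ ·) s ∧
          s.head? ≠ some ((g.take D ++ (g'.take D).reverse).getD (D - 1) 0)) := by
  rw [mem_redWords] at hg hg'
  obtain ⟨hgl, hgc, hgh⟩ := hg
  obtain ⟨hgl', hgc', hgh'⟩ := hg'
  have hgg : g ≠ g' := by
    intro hgg
    apply hne
    rw [hgg] at h1
    rw [eq_of_foldl_act_eq μ hμ g' h1, hgg]
  have hDpos : 0 < D := hD ▸ find_pos_of_ne hgg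
  have hDk : D ≤ k := hD ▸ find_le_of_length_le hgl.le hgl'.le
  have hDg : D ≤ g.length := hgl ▸ hDk
  have hDg' : D ≤ g'.length := hgl' ▸ hDk
  have hdrop : g.drop D = g'.drop D := by
    rw [hD]
    exact drop_find_eq g g'
  have hlp : (g.take D).length = D := by rw [List.length_take, min_eq_left hDg]
  have hlp' : (g'.take D).length = D := by rw [List.length_take, min_eq_left hDg']
  have key : ∀ x x' : Fin n, g.foldl (fun v e => μ e v) x = g'.foldl (fun v e => μ e v) x' →
      (g.take D).foldl (fun v e => μ e v) x = (g'.take D).foldl (fun v e => μ e v) x' := by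
    intro x x' hx
    rw [← List.take_append_drop D g, ← List.take_append_drop D g', List.foldl_append,
      List.foldl_append, hdrop] at hx
    exact eq_of_foldl_act_eq μ hμ _ hx
  have hact : ∀ x x' : Fin n, g.foldl (fun v e => μ e v) x = g'.foldl (fun v e => μ e v) x' →
      (g.take D ++ (g'.take D).reverse).foldl (fun v e => μ e v) x = x' := by
    intro x x' hx
    rw [List.foldl_append, key x x' hx, ← List.foldl_append, foldl_append_reverse_self μ hμ]
  refine ⟨⟨hDpos, hDk⟩, ⟨hact a a' h1, hact _ _ h2⟩, ?_, ?_⟩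
  · rw [mem_filter, mem_product]
    refine ⟨⟨mem_univ _, mem_image.2 ⟨⟨_, ?_⟩, mem_univ _, rfl⟩⟩, ?_, ?_, ?_, ?_⟩
    · rw [List.length_append, List.length_reverse, hlp, hlp']
      ring
    · rw [List.isChain_append]
      refine ⟨hgc.take D, ?_, ?_⟩
      · exact List.isChain_reverse.2 ((hgc'.take D).imp fun _ _ h => h.symm)
      · intro x hx y hy
        rw [getLast?_take hDpos hDg] at hx
        rw [List.head?_reverse, getLast?_take hDpos hDg'] at hy
        have hx' : x = g[D - 1] := by simpa [eq_comm] using hx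
        have hy' : y = g'[D - 1] := by simpa [eq_comm] using hy
        rw [hx', hy']
        exact getElem_ne_of_find hD hDpos (by omega) (by omega)
    · rw [head?_take_append hDpos (by omega)]
      exact hgh
    · rw [getLast?_append_reverse_take hDpos (by omega)]
      exact hgh'
    · show (g.take D ++ (g'.take D).reverse).foldl (fun v e => μ e v) (μ c a) =
        μ c ((g.take D ++ (g'.take D).reverse).foldl (fun v e => μ e v) a)
      rw [hact a a' h1, hact _ _ h2]
  · rw [mem_redWords]
    refine ⟨by rw [List.length_drop, hgl], hgc.drop D, ?_⟩
    have hget : (g.take D ++ (g'.take D).reverse).getD (D - 1) 0 = g[D - 1] := by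
      rw [List.getD_eq_getElem?_getD, List.getElem?_append_left (by rw [hlp]; omega),
        List.getElem?_take, if_pos (by omega), List.getElem?_eq_getElem (by omega), Option.getD_some]
    rw [hget]
    have hchain : List.IsChain (· ≠ ·) (g.take D ++ g.drop D) := by
      rw [List.take_append_drop]
      exact hgc
    have hj := (List.isChain_append.1 hchain).2.2
    intro hs
    exact hj _ (Option.mem_def.2 (getLast?_take hDpos hDg)) _ (Option.mem_def.2 hs) rfl

/-! ### Counting the collisions by structures -/

/-- **Collisions inject into (split index, structure, suffix).**  The collisions of the item map
`(a, g) ↦ (a · g, (μ c a) · g)` (items: `a : Fin n`, `g` reduced of length `k` not starting with `c`)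
number at most `Σ_{d=1}^{k} 2^(k-d) · #{same-colour reflection structures of colour c and length 2d}`.
[this line; crux NOTES §15.1] -/
theorem card_collisions_le (μ : Fin 3 → Equiv.Perm (Fin n)) (hμ : ∀ c, μ c * μ c = 1) (c : Fin 3)
    (k : ℕ) :
    ((((univ : Finset (Fin n)) ×ˢ (((univ : Finset (List.Vector (Fin 3) k)).image
        (fun v => v.toList)).filter (fun g => List.IsChain (· ≠ ·) g ∧ g.head? ≠ some c))) ×ˢ
      ((univ : Finset (Fin n)) ×ˢ (((univ : Finset (List.Vector (Fin 3) k)).image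
        (fun v => v.toList)).filter (fun g => List.IsChain (· ≠ ·) g ∧ g.head? ≠ some c)))).filter
      (fun p => p.1 ≠ p.2 ∧
        (p.1.2.foldl (fun v e => μ e v) p.1.1, p.1.2.foldl (fun v e => μ e v) (μ c p.1.1)) =
        (p.2.2.foldl (fun v e => μ e v) p.2.1, p.2.2.foldl (fun v e => μ e v) (μ c p.2.1)))).card ≤
    ∑ d ∈ Icc 1 k, 2 ^ (k - d) *
      (((univ : Finset (Fin n)) ×ˢ
          ((univ : Finset (List.Vector (Fin 3) (2 * d))).image (fun v => v.toList))).filter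
        (fun ah => List.IsChain (· ≠ ·) ah.2 ∧ ah.2.head? ≠ some c ∧ ah.2.getLast? ≠ some c ∧
          ah.2.foldl (fun v e => μ e v) (μ c ah.1) = μ c (ah.2.foldl (fun v e => μ e v) ah.1))).card := by
  -- the target: (d, (a, h), s)
  set T : Finset (ℕ × (Fin n × List (Fin 3)) × List (Fin 3)) := (Icc 1 k).biUnion (fun d =>
    ((((univ : Finset (Fin n)) ×ˢ
          ((univ : Finset (List.Vector (Fin 3) (2 * d))).image (fun v => v.toList))).filter
        (fun ah => List.IsChain (· ≠ ·) ah.2 ∧ ah.2.head? ≠ some c ∧ ah.2.getLast? ≠ some c ∧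
          ah.2.foldl (fun v e => μ e v) (μ c ah.1) = μ c (ah.2.foldl (fun v e => μ e v) ah.1))).biUnion
      (fun ah => (((univ : Finset (List.Vector (Fin 3) (k - d))).image (fun v => v.toList)).filter
        (fun s => List.IsChain (· ≠ ·) s ∧ s.head? ≠ some (ah.2.getD (d - 1) 0))).image
          (fun s => (d, ah, s))))) with hT
  -- the map
  set φ : (Fin n × List (Fin 3)) × (Fin n × List (Fin 3)) → ℕ × (Fin n × List (Fin 3)) × List (Fin 3) :=
    fun p => (Nat.find (exists_drop_eq p.1.2 p.2.2),
      (p.1.1, p.1.2.take (Nat.find (exists_drop_eq p.1.2 p.2.2)) ++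
        (p.2.2.take (Nat.find (exists_drop_eq p.1.2 p.2.2))).reverse),
      p.1.2.drop (Nat.find (exists_drop_eq p.1.2 p.2.2))) with hφ
  have hTcard : T.card ≤ ∑ d ∈ Icc 1 k, 2 ^ (k - d) *
      (((univ : Finset (Fin n)) ×ˢ
          ((univ : Finset (List.Vector (Fin 3) (2 * d))).image (fun v => v.toList))).filter
        (fun ah => List.IsChain (· ≠ ·) ah.2 ∧ ah.2.head? ≠ some c ∧ ah.2.getLast? ≠ some c ∧
          ah.2.foldl (fun v e => μ e v) (μ c ah.1) = μ c (ah.2.foldl (fun v e => μ e v) ah.1))).card := by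
    rw [hT]
    refine card_biUnion_le.trans (sum_le_sum fun d _ => ?_)
    refine card_biUnion_le.trans ?_
    refine (sum_le_sum fun ah _ => card_image_le).trans ?_
    simp_rw [card_redWords]
    rw [sum_const, smul_eq_mul, mul_comm]
  refine le_trans ?_ hTcard
  refine card_le_card_of_injOn φ ?_ ?_
  · -- maps to
    rintro ⟨⟨a, g⟩, ⟨a', g'⟩⟩ hp
    have hp' := mem_filter.1 (Finset.mem_coe.1 hp)
    obtain ⟨hX, hne, hF⟩ := hp'
    rw [mem_product, mem_product, mem_product] at hX
    obtain ⟨⟨-, hg⟩, -, hg'⟩ := hX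
    obtain ⟨h1, h2⟩ := Prod.mk.inj hF
    obtain ⟨⟨hD1, hDk⟩, -, hS, hs⟩ := collision_structure μ hμ c hg hg' hne h1 h2 rfl
    refine Finset.mem_coe.2 (mem_biUnion.2 ⟨Nat.find (exists_drop_eq g g'), mem_Icc.2 ⟨hD1, hDk⟩,
      mem_biUnion.2 ⟨_, hS, mem_image.2 ⟨_, hs, rfl⟩⟩⟩)
  · -- injective
    rintro ⟨⟨a, g⟩, ⟨a', g'⟩⟩ hp ⟨⟨b, f⟩, ⟨b', f'⟩⟩ hq hpq
    have hp' := mem_filter.1 (Finset.mem_coe.1 hp)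
    obtain ⟨hX, hne, hF⟩ := hp'
    rw [mem_product, mem_product, mem_product] at hX
    obtain ⟨⟨-, hg⟩, -, hg'⟩ := hX
    obtain ⟨h1, h2⟩ := Prod.mk.inj hF
    have hq' := mem_filter.1 (Finset.mem_coe.1 hq)
    obtain ⟨hY, hne', hF'⟩ := hq'
    rw [mem_product, mem_product, mem_product] at hY
    obtain ⟨⟨-, hf⟩, -, hf'⟩ := hY
    obtain ⟨h1', h2'⟩ := Prod.mk.inj hF'
    obtain ⟨⟨hD1, hDk⟩, ⟨hact, -⟩, -, -⟩ := collision_structure μ hμ c hg hg' hne h1 h2 rfl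
    obtain ⟨⟨hE1, hEk⟩, ⟨hact', -⟩, -, -⟩ := collision_structure μ hμ c hf hf' hne' h1' h2' rfl
    simp only [hφ, Prod.mk.injEq] at hpq
    obtain ⟨hDE, ⟨hab, hh⟩, hs⟩ := hpq
    set D := Nat.find (exists_drop_eq g g') with hD
    set E := Nat.find (exists_drop_eq f f') with hE
    have hgl : g.length = k := (mem_redWords.1 hg).1
    have hgl' : g'.length = k := (mem_redWords.1 hg').1
    have hfl : f.length = k := (mem_redWords.1 hf).1
    have hfl' : f'.length = k := (mem_redWords.1 hf').1
    have hlp : (g.take D).length = D := by rw [List.length_take, min_eq_left (hgl ▸ hDk)]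
    have hlq : (f.take E).length = E := by rw [List.length_take, min_eq_left (hfl ▸ hEk)]
    -- recover g = f
    have hgf : g = f := by
      rw [← List.take_append_drop D g, ← List.take_append_drop E f, hs]
      congr 1
      rw [← List.take_left' (l₂ := (g'.take D).reverse) hlp, hh, hDE, List.take_left' hlq]
    -- recover g' = f'
    have hg'f' : g' = f' := by
      rw [← List.take_append_drop D g', ← List.take_append_drop E f', ← drop_find_eq g g',
        ← drop_find_eq f f']
      show g'.take D ++ g.drop D = f'.take E ++ f.drop E
      rw [hs]
      congr 1
      have e1 : (g.take D ++ (g'.take D).reverse).drop D = (g'.take D).reverse := List.drop_left' hlp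
      have e2 : (f.take E ++ (f'.take E).reverse).drop E = (f'.take E).reverse := List.drop_left' hlq
      calc g'.take D = ((g.take D ++ (g'.take D).reverse).drop D).reverse := by
            rw [e1, List.reverse_reverse]
        _ = ((f.take E ++ (f'.take E).reverse).drop E).reverse := by rw [hh, hDE]
        _ = f'.take E := by rw [e2, List.reverse_reverse]
    -- recover a' = b'
    have hab' : a' = b' := by rw [← hact, ← hact', hh, hab]
    rw [hab, hgf, hab', hg'f']

/-- The two presentations of the structure set — one filter on pairs (used in the proofs above) versus
"filter the words, then the pairs" with the condition written `μ c (a · h) = (μ c a) · h` (the presentation of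
the lead's registered `stub_sameColourSupply`) — are the same finset. -/
theorem structures_eq (μ : Fin 3 → Equiv.Perm (Fin n)) (c : Fin 3) (m : ℕ) :
    (((univ : Finset (Fin n)) ×ˢ
          ((univ : Finset (List.Vector (Fin 3) m)).image (fun v => v.toList))).filter
        (fun ah => List.IsChain (· ≠ ·) ah.2 ∧ ah.2.head? ≠ some c ∧ ah.2.getLast? ≠ some c ∧
          ah.2.foldl (fun v e => μ e v) (μ c ah.1) = μ c (ah.2.foldl (fun v e => μ e v) ah.1))) =
    (((univ : Finset (Fin n)) ×ˢ (((univ : Finset (List.Vector (Fin 3) m)).image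
          (fun v => v.toList)).filter
            (fun g => List.IsChain (· ≠ ·) g ∧ g.head? ≠ some c ∧ g.getLast? ≠ some c))).filter
        (fun p => μ c (p.2.foldl (fun v b => μ b v) p.1) = p.2.foldl (fun v b => μ b v) (μ c p.1))) := by
  ext ⟨a, h⟩
  simp only [mem_filter, mem_product, mem_univ, true_and]
  constructor
  · rintro ⟨hw, hc, hh, hl, he⟩
    exact ⟨⟨hw, hc, hh, hl⟩, he.symm⟩
  · rintro ⟨⟨hw, hc, hh, hl⟩, he⟩
    exact ⟨hw, hc, hh, hl, he.symm⟩

/-- **Single-colour reflection supply (pigeonhole on involution words), off-diagonal form.**  For three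
fixed-point-free involutions `μ` on `Fin n`, a colour `c` and any `k`:

  `(n · 2^k)² ≤ (n² - n) · (n · 2^k + Σ_{d=1}^{k} 2^(k-d) · Π_c(2d))`,

where `Π_c(m)` is the number of based oriented SAME-COLOUR REFLECTION STRUCTURES of colour `c` and length
`m`: pairs `(a, h)` with `h` a reduced colour word of length `m` neither starting nor ending with `c` and
`μ c (a · h) = (μ c a) · h` — the `c`-edge `{a, μ c a}` is carried by `h` onto the `c`-edge at `a · h`
(equivalently `a ∈ Fix (c h c h⁻¹)`, `structure_iff_foldl_commutator`).
Proof: the `n · 2^k` items `(a, g)` (`g` reduced of length `k`, first letter `≠ c` — the involution words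
`g⁻¹ c g`) are mapped to the `n² - n` ordered pairs `(a · g, (μ c a) · g)` of DISTINCT points
(fixed-point-freeness + right cancellation); Cauchy–Schwarz on the fibres gives
`(n 2^k)² ≤ (n² - n)(n 2^k + #collisions)`, and `card_collisions_le` bounds the collisions by the structures.
This is (15.1) of the crux notes with the sharp suffix weight `2^(k-d)`; the lead's registered
`stub_sameColourSupply` (weight `3^i`, index `i = k - d`) follows from it and `sum_Icc_le_sum_range_three_pow`.
[this line; crux NOTES §15.1, §9 (S1)] -/
theorem sq_le_offDiag_mul_sameColourStructures (μ : Fin 3 → Equiv.Perm (Fin n))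
    (hμ : ∀ c, μ c * μ c = 1) (hfp : ∀ c v, μ c v ≠ v) (c : Fin 3) (k : ℕ) :
    (n * 2 ^ k) ^ 2 ≤ (n * n - n) * (n * 2 ^ k + ∑ d ∈ Icc 1 k, 2 ^ (k - d) *
      (((univ : Finset (Fin n)) ×ˢ (((univ : Finset (List.Vector (Fin 3) (2 * d))).image
          (fun v => v.toList)).filter
            (fun g => List.IsChain (· ≠ ·) g ∧ g.head? ≠ some c ∧ g.getLast? ≠ some c))).filter
        (fun p => μ c (p.2.foldl (fun v b => μ b v) p.1) = p.2.foldl (fun v b => μ b v) (μ c p.1))).card) := by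
  set X : Finset (Fin n × List (Fin 3)) := (univ : Finset (Fin n)) ×ˢ
    (((univ : Finset (List.Vector (Fin 3) k)).image (fun v => v.toList)).filter
      (fun g => List.IsChain (· ≠ ·) g ∧ g.head? ≠ some c)) with hX
  have hXcard : X.card = n * 2 ^ k := by
    rw [hX, card_product, card_univ, Fintype.card_fin, card_redWords]
  have hCS := card_sq_le_card_mul_collisions X (univ : Finset (Fin n)).offDiag
    (fun ag => (ag.2.foldl (fun v e => μ e v) ag.1, ag.2.foldl (fun v e => μ e v) (μ c ag.1))) (by
      rintro ⟨a, g⟩ -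
      rw [mem_offDiag]
      refine ⟨mem_univ _, mem_univ _, fun h => ?_⟩
      exact hfp c a (eq_of_foldl_act_eq μ hμ g h).symm)
  rw [offDiag_card, card_univ, Fintype.card_fin, hXcard] at hCS
  have hcoll := card_collisions_le μ hμ c k
  simp_rw [structures_eq μ c] at hcoll
  exact hCS.trans (Nat.mul_le_mul_left _ (Nat.add_le_add_left hcoll _))

/-- **Single-colour reflection supply, density form.**  Without fixed-point-freeness (all `n²` ordered pairs
as targets) the same count reads, for `0 < n`:  `4^k ≤ n · 2^k + Σ_{d=1}^{k} 2^(k-d) · Π_c(2d)`.  Reading: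
with `2^k = 2^{C/2} n` and `ρ_m := Π_c(m) / 2^m` this is `Σ_{i<k} ρ_{2k-2i} 2^{-i} ≥ 1 - 2^{-C/2}`, so some
scale `m ≤ 2k ≈ 2 log₂ n + C` carries `Π_c(m) ≳ 2^m` structures — the supply against which cleanness has to
be counted (crux NOTES §15.2).  What is NOT here: cleanness of any structure. [this line; crux NOTES §15.1] -/
theorem four_pow_le_sameColourStructures (hn : 0 < n) (μ : Fin 3 → Equiv.Perm (Fin n))
    (hμ : ∀ c, μ c * μ c = 1) (c : Fin 3) (k : ℕ) :
    4 ^ k ≤ n * 2 ^ k + ∑ d ∈ Icc 1 k, 2 ^ (k - d) *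
      (((univ : Finset (Fin n)) ×ˢ (((univ : Finset (List.Vector (Fin 3) (2 * d))).image
          (fun v => v.toList)).filter
            (fun g => List.IsChain (· ≠ ·) g ∧ g.head? ≠ some c ∧ g.getLast? ≠ some c))).filter
        (fun p => μ c (p.2.foldl (fun v b => μ b v) p.1) = p.2.foldl (fun v b => μ b v) (μ c p.1))).card := by
  set X : Finset (Fin n × List (Fin 3)) := (univ : Finset (Fin n)) ×ˢ
    (((univ : Finset (List.Vector (Fin 3) k)).image (fun v => v.toList)).filter
      (fun g => List.IsChain (· ≠ ·) g ∧ g.head? ≠ some c)) with hX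
  have hXcard : X.card = n * 2 ^ k := by
    rw [hX, card_product, card_univ, Fintype.card_fin, card_redWords]
  have hCS := card_sq_le_card_mul_collisions X (univ : Finset (Fin n × Fin n))
    (fun ag => (ag.2.foldl (fun v e => μ e v) ag.1, ag.2.foldl (fun v e => μ e v) (μ c ag.1)))
    (fun _ _ => mem_univ _)
  rw [card_univ, Fintype.card_prod, Fintype.card_fin, hXcard] at hCS
  have hcoll := card_collisions_le μ hμ c k
  simp_rw [structures_eq μ c] at hcoll
  have h3 := hCS.trans (Nat.mul_le_mul_left _ (Nat.add_le_add_left hcoll _))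
  have e4 : (n * 2 ^ k) ^ 2 = n * n * 4 ^ k := by
    rw [show (4 : ℕ) = 2 ^ 2 from rfl, ← pow_mul, mul_comm 2 k, pow_mul]
    ring
  rw [e4] at h3
  exact Nat.le_of_mul_le_mul_left h3 (Nat.mul_pos hn hn)

/-- Re-indexing towards the lead's registered form: with `i = k - d` and the cruder suffix weight `3^i ≥ 2^i`,
`Σ_{d ∈ [1,k]} 2^(k-d) f(2d) ≤ Σ_{i < k} 3^i f(2k - 2i)` for any `f : ℕ → ℕ`. -/
theorem sum_Icc_le_sum_range_three_pow (f : ℕ → ℕ) (k : ℕ) :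
    ∑ d ∈ Icc 1 k, 2 ^ (k - d) * f (2 * d) ≤ ∑ i ∈ range k, 3 ^ i * f (2 * k - 2 * i) := by
  have h : ∑ d ∈ Icc 1 k, 2 ^ (k - d) * f (2 * d) = ∑ i ∈ range k, 2 ^ i * f (2 * k - 2 * i) := by
    refine sum_nbij' (fun d => k - d) (fun i => k - i) ?_ ?_ ?_ ?_ ?_
    · intro d hd
      rw [mem_Icc] at hd
      rw [mem_range]
      omega
    · intro i hi
      rw [mem_range] at hi
      rw [mem_Icc]
      omega
    · intro d hd
      rw [mem_Icc] at hd
      show k - (k - d) = d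
      omega
    · intro i hi
      rw [mem_range] at hi
      show k - (k - i) = i
      omega
    · intro d hd
      rw [mem_Icc] at hd
      show 2 ^ (k - d) * f (2 * d) = 2 ^ (k - d) * f (2 * k - 2 * (k - d))
      congr 2
      omega
  rw [h]
  exact sum_le_sum fun i _ => Nat.mul_le_mul_right _ (Nat.pow_le_pow_left (by norm_num) i)

/-- **Structures are fixed points of commutators.**  `(a, h)` is a same-colour reflection structure of
colour `c` iff `a` is fixed by the word `c h c h⁻¹` (`h⁻¹ = h.reverse`, letters being involutions):
`(μ c a) · h = μ c (a · h) ↔ a · (c :: h ++ c :: h.reverse) = a`.  (Links `Π_c` to the `Fix z`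
vocabulary of the line's stubs; the word `c :: h ++ c :: h.reverse` is cyclically reduced exactly when `h` is
reduced with `first(h) ≠ c ≠ last(h)`.) [this line] -/
theorem structure_iff_foldl_commutator (μ : Fin 3 → Equiv.Perm (Fin n)) (hμ : ∀ c, μ c * μ c = 1)
    (c : Fin 3) (a : Fin n) (h : List (Fin 3)) :
    h.foldl (fun v e => μ e v) (μ c a) = μ c (h.foldl (fun v e => μ e v) a) ↔
      (c :: (h ++ c :: h.reverse)).foldl (fun v e => μ e v) a = a := by
  have hcc : ∀ x : Fin n, μ c (μ c x) = x := fun x => by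
    have := congrArg (fun f : Equiv.Perm (Fin n) => f x) (hμ c)
    simpa using this
  rw [List.foldl_cons, List.foldl_append, List.foldl_cons]
  constructor
  · intro H
    rw [H, hcc, ← List.foldl_append, foldl_append_reverse_self μ hμ]
  · intro H
    have e := foldl_append_reverse_self μ hμ h.reverse (μ c (h.foldl (fun v e => μ e v) (μ c a)))
    rw [List.reverse_reverse, List.foldl_append, H] at e
    rw [e, hcc]

/-- Registered form (`stub_sameColourSupplySharp`; `--supports` plumbing for crux stmt-MatrixMultiplication-10883):
`sq_le_offDiag_mul_sameColourStructures` verbatim, hypotheses first. -/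
theorem stub_sameColourSupplySharp : ∀ (n k : ℕ) (μ : Fin 3 → Equiv.Perm (Fin n)) (c : Fin 3), (∀ b, μ b * μ b = 1) → (∀ b v, μ b v ≠ v) → (n * 2 ^ k) ^ 2 ≤ (n * n - n) * (n * 2 ^ k + ∑ d ∈ Finset.Icc 1 k, 2 ^ (k - d) * (((Finset.univ : Finset (Fin n)) ×ˢ (((Finset.univ : Finset (List.Vector (Fin 3) (2 * d))).image (fun v => v.toList)).filter (fun g => List.IsChain (· ≠ ·) g ∧ g.head? ≠ some c ∧ g.getLast? ≠ some c))).filter (fun p => μ c (p.2.foldl (fun v b => μ b v) p.1) = p.2.foldl (fun v b => μ b v) (μ c p.1))).card) :=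
  fun _ k μ c hμ hfp => sq_le_offDiag_mul_sameColourStructures μ hμ hfp c k

end Summit.MatrixMultiplication.MatrixMultiplication.Theorems.HyperoctahedralThreshold.SameColourSupply
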